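import Mathlib
import Summits.ValiantsHypothesis.ValiantsHypothesis.Theorems.NewtonUnitEquationsTwoProductsFormalLogLinearisationShiftRankCross
import HarnessLib

/-!
# Route NewtonUnitEquations — crux `TwoProducts` (stmt-ValiantsHypothesis-5906), line `relation_ladder` (rung R6 tool):
# the PER-CELL BOUND and the PENCIL COUNT for functions of finite shift rank

Helper mode (`--supports stmt-ValiantsHypothesis-5906 --as helper`, no stub credit claimed; val-lit-p3 g14 for the
`relation_ladder` R6 tool `BinExpPencilCount` of val-idea-8 g3).  Sequel to `…ShiftRankCross.lean`.

For a function `F : (Fin s → ℕ) → ℂ` of finite shift rank, `F(β + w) = Σ_{i∈ι} col β i · ch i w`: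

* `ShiftRank.pencilCount_cell` — a CELL FAMILY of pencil-visible points (each member `μ` has `F(μ) ≠ 0` and a
  parameter `t` at which it is the strict `(u + t v)`-minimiser of `{F ≠ 0}`, all `t` inducing one fixed weight order
  `R` on the coordinates) has at most `(log₂|ι| + 1)·|ι|^(2·log₂|ι|)` members — the body of `ExpSum.pencilCount_cell`
  (p595517 lineage) verbatim, fed with `ShiftRank.hyperbolicCross` / `ShiftRank.slotRank_card_le`;
* `ShiftRank.pencilCount` — sweeping the `≤ 2(s²+1)` cells of a real pencil (`pencilOrder_classes`):
  every finite set of pencil-visible points has at most `2(s²+1)·(log₂|ι| + 1)·|ι|^(2 log₂|ι|)` elements.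

Honest framing: elementary counting (copy-adaptation of landed proofs) for the THEORY lane of the `relation_ladder`
line; the crux `TwoProducts` (stmt-5906) stays OPEN, no rung of record moves, and nothing here is progress on
`VP ≠ VNP` (NOT proved).  No definitions, no named facts. [folklore]
-/

noncomputable section

-- Sub = Summit single-conjunct layout: the duplicated namespace component is mandated by the tree.
set_option linter.dupNamespace false

namespace Summit.ValiantsHypothesis.ValiantsHypothesis.Theorems.NewtonUnitEquations.TwoProducts.FormalLogLinearisation

open scoped BigOperators

namespace ShiftRank

variable {s : ℕ}

/-- **PER-CELL BOUND (finite shift rank).**  Let `F(β + w) = Σ_{i∈ι} col β i · ch i w` and let `C` be a CELL FAMILY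
of pencil-visible points: each `μ ∈ C` has `F(μ) ≠ 0` and a parameter `t` at which it is the strict
`(u + t v)`-minimiser of `{F ≠ 0}` and at which the weight order of the coordinates is the fixed relation `R`.  Then
`#C ≤ (log₂|ι| + 1) · |ι|^(2·log₂|ι|)`. [folklore] -/
theorem pencilCount_cell {ι : Type*} [Fintype ι] {F : (Fin s → ℕ) → ℂ} {col : (Fin s → ℕ) → ι → ℂ}
    {ch : ι → (Fin s → ℕ) → ℂ} (hF : ∀ β w : Fin s → ℕ, F (β + w) = ∑ i, col β i * ch i w) (u v : Fin s → ℝ)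
    (R : Fin s → Fin s → Prop) (C : Finset (Fin s → ℕ))
    (hC : ∀ μ ∈ C, F μ ≠ 0 ∧ ∃ t : ℝ,
      (∀ ν : Fin s → ℕ, ν ≠ μ → F ν ≠ 0 →
        ∑ i, (u i + t * v i) * (μ i : ℝ) < ∑ i, (u i + t * v i) * (ν i : ℝ)) ∧
      (∀ j j' : Fin s, R j j' ↔ (u j + t * v j ≤ u j' + t * v j'))) :
    C.card ≤ (Nat.log 2 (Fintype.card ι) + 1) * Fintype.card ι ^ (2 * Nat.log 2 (Fintype.card ι)) := by
  classical
  set n := Fintype.card ι with hn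
  set Lm := Nat.log 2 n with hLm
  -- choose the parameters
  have hC' : ∀ μ ∈ C, ∃ t : ℝ, (∀ ν : Fin s → ℕ, ν ≠ μ → F ν ≠ 0 →
      ∑ i, (u i + t * v i) * (μ i : ℝ) < ∑ i, (u i + t * v i) * (ν i : ℝ)) ∧
      (∀ j j' : Fin s, R j j' ↔ (u j + t * v j ≤ u j' + t * v j')) := fun μ hμ => (hC μ hμ).2
  -- structural facts: hyperbolic cross, support and exponents
  have hcrossC : ∀ μ ∈ C, ∏ i, (μ i + 1) ≤ n := by
    intro μ hμ
    obtain ⟨t, hvis, -⟩ := hC' μ hμ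
    rw [hn]
    refine hyperbolicCross hF (fun i => u i + t * v i) μ (hC μ hμ).1 fun ν hν hle => ?_
    by_contra h
    have := hvis ν hν h
    linarith
  -- degenerate cases
  rcases Nat.eq_zero_or_pos n with hn0 | hnpos
  · -- `|ι| = 0`: no visible point at all
    have hC0 : C = ∅ := by
      refine Finset.eq_empty_of_forall_notMem fun μ hμ => ?_
      have h1 := hcrossC μ hμ
      have h2 : 0 < ∏ i, (μ i + 1) := Finset.prod_pos fun i _ => Nat.succ_pos _
      omega
    simp [hC0]
  rcases Nat.eq_zero_or_pos s with hs0 | hspos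
  · -- no coordinates: at most one function `Fin 0 → ℕ`
    subst hs0
    have : C.card ≤ 1 := Finset.card_le_one.2 fun μ _ μ' _ => funext fun i => i.elim0
    calc C.card ≤ 1 := this
      _ ≤ (Lm + 1) * n ^ (2 * Lm) := Nat.one_le_iff_ne_zero.2 (by positivity)
  obtain ⟨i₀⟩ : Nonempty (Fin s) := ⟨⟨0, hspos⟩⟩
  have hsupp : ∀ μ ∈ C, (Finset.univ.filter fun i => μ i ≠ 0).card ≤ Lm := fun μ hμ =>
    card_support_le_log_of_prod_le μ (hcrossC μ hμ)
  have hexp : ∀ μ ∈ C, ∀ i, μ i < n := by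
    intro μ hμ i
    have hcross := hcrossC μ hμ
    have hdvd : (μ i + 1) ∣ ∏ j, (μ j + 1) := Finset.dvd_prod_of_mem (fun j => μ j + 1) (Finset.mem_univ i)
    have hle : μ i + 1 ≤ ∏ j, (μ j + 1) := Nat.le_of_dvd (Finset.prod_pos fun j _ => Nat.succ_pos _) hdvd
    exact Nat.lt_of_lt_of_le (Nat.lt_succ_self _) (hle.trans hcross)
  -- labelling of the support: slot `l` ↦ the `l`-th coordinate of the support (increasing), junk beyond
  let supp : (Fin s → ℕ) → Finset (Fin s) := fun μ => Finset.univ.filter fun i => μ i ≠ 0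
  let lab : (Fin s → ℕ) → ℕ → Fin s := fun μ l =>
    if h : l < (supp μ).card then (supp μ).orderEmbOfFin rfl ⟨l, h⟩ else i₀
  have hlab_mem : ∀ μ l, l < (supp μ).card → μ (lab μ l) ≠ 0 := by
    intro μ l hl
    have : lab μ l ∈ supp μ := by
      simp only [lab, dif_pos hl]; exact Finset.orderEmbOfFin_mem _ _ _
    simpa [supp] using this
  have hlab_inj : ∀ μ l l', l < (supp μ).card → l' < (supp μ).card → lab μ l = lab μ l' → l = l' := by
    intro μ l l' hl hl' h
    simp only [lab, dif_pos hl, dif_pos hl'] at h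
    have := ((supp μ).orderEmbOfFin rfl).injective h
    simpa using this
  have hlab_surj : ∀ μ i, μ i ≠ 0 → ∃ l, l < (supp μ).card ∧ lab μ l = i := by
    intro μ i hi
    have hi' : i ∈ supp μ := by simpa [supp] using hi
    have : i ∈ Set.range ((supp μ).orderEmbOfFin rfl) := by
      rw [Finset.range_orderEmbOfFin]; exact hi'
    obtain ⟨⟨l, hl⟩, hl'⟩ := this
    exact ⟨l, hl, by simp only [lab, dif_pos hl]; exact hl'⟩
  -- the shape key
  let key : (Fin s → ℕ) → ℕ × (Fin Lm → ℕ) := fun μ =>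
    ((supp μ).card, fun l => if (l : ℕ) < (supp μ).card then μ (lab μ l) else 0)
  have hkey_img : C.image key ⊆ (Finset.range (Lm + 1)) ×ˢ (Fintype.piFinset fun _ : Fin Lm => Finset.range n) := by
    intro k hk
    obtain ⟨μ, hμ, rfl⟩ := Finset.mem_image.1 hk
    refine Finset.mem_product.2 ⟨Finset.mem_range.2 (Nat.lt_succ_of_le (hsupp μ hμ)), ?_⟩
    refine Fintype.mem_piFinset.2 fun l => Finset.mem_range.2 ?_
    simp only [key]
    split_ifs
    · exact hexp μ hμ _
    · exact hnpos
  have hkey_card : (C.image key).card ≤ (Lm + 1) * n ^ Lm := by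
    refine (Finset.card_le_card hkey_img).trans ?_
    rw [Finset.card_product, Finset.card_range, Fintype.card_piFinset, Finset.prod_const, Finset.card_range,
      Finset.card_univ, Fintype.card_fin]
  -- fibre bound
  have hfib : ∀ k ∈ C.image key, (C.filter fun μ => key μ = k).card ≤ n ^ (Lm - 1) := by
    intro k hk
    obtain ⟨μ₀, hμ₀, rfl⟩ := Finset.mem_image.1 hk
    set L := (supp μ₀).card with hL
    set G := C.filter fun μ => key μ = key μ₀ with hG
    have hGmem : ∀ μ ∈ G, μ ∈ C ∧ (supp μ).card = L ∧ ∀ l, l < L → μ (lab μ l) = μ₀ (lab μ₀ l) := by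
      intro μ hμ
      obtain ⟨hμC, hk⟩ := Finset.mem_filter.1 hμ
      have h1 : (supp μ).card = L := by simpa [key] using congrArg Prod.fst hk
      refine ⟨hμC, h1, fun l hl => ?_⟩
      have hlLm : l < Lm := lt_of_lt_of_le hl (hL ▸ hsupp μ₀ hμ₀)
      have h2 := congrFun (congrArg Prod.snd hk) ⟨l, hlLm⟩
      simpa [key, h1, hl, ← hL] using h2
    have hLle : L ≤ Lm := hsupp μ₀ hμ₀
    -- slot sets are small (slot-rank lemma)
    have hslot : ∀ l, l < L → (G.image fun μ => lab μ l).card ≤ n := by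
      intro l hl
      set e := μ₀ (lab μ₀ l) with he
      have he1 : 1 ≤ e := Nat.one_le_iff_ne_zero.2 (hlab_mem μ₀ l (hL ▸ hl))
      -- representatives
      have hrepex : ∀ d ∈ G.image (fun μ => lab μ l), ∃ μ ∈ G, lab μ l = d := fun d hd => by
        simpa only [Finset.mem_image] using hd
      choose! rep hrepG hrepl using hrepex
      obtain ⟨t₀, -, hR₀⟩ := hC' μ₀ hμ₀
      have hτ : ∀ d ∈ G.image (fun μ => lab μ l), ∃ τ : ℝ,
          (∀ ν : Fin s → ℕ, ν ≠ rep d → F ν ≠ 0 →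
            ∑ i, (u i + τ * v i) * (rep d i : ℝ) < ∑ i, (u i + τ * v i) * (ν i : ℝ)) ∧
          (∀ j j' : Fin s, (u j + τ * v j ≤ u j' + τ * v j') ↔ (u j + t₀ * v j ≤ u j' + t₀ * v j')) := by
        intro d hd
        obtain ⟨τ, hvis, hR⟩ := hC' (rep d) (hGmem _ (hrepG d hd)).1
        exact ⟨τ, hvis, fun j j' => by rw [← hR j j', hR₀ j j']⟩
      choose! τ hτvis hτR using hτ
      rw [hn]
      refine slotRank_card_le hF u v e he1 t₀ _ rep τ fun d hd => ⟨?_, ?_, hτvis d hd, hτR d hd⟩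
      · have := (hGmem _ (hrepG d hd)).2.2 l hl
        rw [hrepl d hd] at this
        exact this
      · exact (hC _ (hGmem _ (hrepG d hd)).1).1
    -- a member is determined by its slots `1, …, L-1`
    have hinj : Set.InjOn (fun μ => fun l : Fin (L - 1) => lab μ ((l : ℕ) + 1)) ↑G := by
      intro μ hμ μ' hμ' hEq
      obtain ⟨hμC, hμL, hμσ⟩ := hGmem μ hμ
      obtain ⟨hμ'C, hμ'L, hμ'σ⟩ := hGmem μ' hμ'
      have htail : ∀ l, 1 ≤ l → l < L → lab μ l = lab μ' l := by
        intro l h1 hl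
        have := congrFun hEq ⟨l - 1, by omega⟩
        simpa [Nat.sub_add_cancel h1] using this
      rcases Nat.eq_zero_or_pos L with hL0 | hLpos
      · -- empty support: both are zero
        funext i
        have h1 : μ i = 0 := by
          by_contra h
          obtain ⟨l, hl, -⟩ := hlab_surj μ i h
          omega
        have h2 : μ' i = 0 := by
          by_contra h
          obtain ⟨l, hl, -⟩ := hlab_surj μ' i h
          omega
        rw [h1, h2]
      set j := lab μ 0 with hj
      set j' := lab μ' 0 with hj'
      set e := μ₀ (lab μ₀ 0) with he
      -- common values off `{j, j'}`
      have hval : ∀ i, i ≠ j → i ≠ j' → μ i = μ' i := by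
        intro i hij hij'
        by_cases hi : μ i = 0
        · by_cases hi' : μ' i = 0
          · rw [hi, hi']
          · exfalso
            obtain ⟨l, hl, hli⟩ := hlab_surj μ' i hi'
            have hl1 : 1 ≤ l := by
              by_contra h0
              have hl0 : l = 0 := by omega
              subst hl0
              exact hij' hli.symm
            have hlabμ : lab μ l = i := by rw [htail l hl1 (by omega), hli]
            have := hlab_mem μ l (by omega)
            rw [hlabμ] at this
            exact this hi
        · obtain ⟨l, hl, hli⟩ := hlab_surj μ i hi
          have hl1 : 1 ≤ l := by
            by_contra h0
            have hl0 : l = 0 := by omega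
            subst hl0
            exact hij hli.symm
          have hli' : lab μ' l = i := by rw [← htail l hl1 (by omega), hli]
          have h1 := hμσ l (by omega)
          have h2 := hμ'σ l (by omega)
          rw [hli] at h1
          rw [hli'] at h2
          rw [h1, h2]
      have hμj : μ j = e := hμσ 0 (by omega)
      have hμ'j' : μ' j' = e := hμ'σ 0 (by omega)
      have he1 : 1 ≤ e := by
        rw [← hμj]; exact Nat.one_le_iff_ne_zero.2 (hlab_mem μ 0 (by omega))
      -- if `j = j'` the points coincide
      by_cases hjj : j = j'
      · funext i
        by_cases hij : i = j
        · rw [hij, hμj]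
          rw [hjj, hμ'j']
        · exact hval i hij (fun h => hij (h.trans hjj.symm))
      -- otherwise `μ' j = 0` and `μ j' = 0`
      have hμ'j : μ' j = 0 := by
        by_contra h
        obtain ⟨l, hl, hli⟩ := hlab_surj μ' j h
        by_cases hl0 : l = 0
        · subst hl0
          exact hjj hli.symm
        · have hlabμ : lab μ l = lab μ 0 := by rw [htail l (by omega) (by omega), hli]
          have := hlab_inj μ l 0 (by omega) (by omega) hlabμ
          exact hl0 this
      have hμj' : μ j' = 0 := by
        by_contra h
        obtain ⟨l, hl, hli⟩ := hlab_surj μ j' h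
        by_cases hl0 : l = 0
        · subst hl0
          exact hjj hli
        · have hlabμ' : lab μ' l = lab μ' 0 := by rw [← htail l (by omega) (by omega), hli]
          have := hlab_inj μ' l 0 (by omega) (by omega) hlabμ'
          exact hl0 this
      -- `μ = ρ + e e_j`, `μ' = ρ + e e_{j'}` with the common remainder `ρ`
      set ρ : Fin s → ℕ := Function.update μ j 0 with hρ
      have hμρ : μ = ρ + (Pi.single j e : Fin s → ℕ) := by
        rw [← hμj]; exact (ExpSum.update_add_single μ j).symm
      have hμ'ρ : μ' = ρ + (Pi.single j' e : Fin s → ℕ) := by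
        funext i
        by_cases hij' : i = j'
        · subst hij'
          simp [hρ, Function.update_of_ne (Ne.symm hjj), hμj', hμ'j']
        · by_cases hij : i = j
          · subst hij
            simp [hρ, hμ'j, hij']
          · simp [hρ, Function.update_of_ne hij, hij', hval i hij hij']
      -- compare along `R`
      have hFμ : F μ ≠ 0 := (hC μ hμC).1
      have hFμ' : F μ' ≠ 0 := (hC μ' hμ'C).1
      have hne : μ ≠ μ' := by
        intro h
        have := congrFun h j
        rw [hμj, hμ'j] at this
        omega
      obtain ⟨t, hvis, hR⟩ := hC' μ hμC
      obtain ⟨t', hvis', hR'⟩ := hC' μ' hμ'C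
      exfalso
      have hepos : (0 : ℝ) ≤ (e : ℝ) := by positivity
      rcases le_total (u j + t' * v j) (u j' + t' * v j') with hle | hle
      · -- `μ` is no heavier than `μ'` at `t'`
        have hlt := hvis' μ hne hFμ
        have hw1 := ExpSum.wsum_add_single u v t' ρ j e
        have hw2 := ExpSum.wsum_add_single u v t' ρ j' e
        rw [← hμρ] at hw1
        rw [← hμ'ρ] at hw2
        have := mul_le_mul_of_nonneg_left hle hepos
        linarith
      · have hle' : u j' + t * v j' ≤ u j + t * v j := (hR _ _).1 ((hR' _ _).2 hle)
        have hlt := hvis μ' (Ne.symm hne) hFμ'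
        have hw1 := ExpSum.wsum_add_single u v t ρ j e
        have hw2 := ExpSum.wsum_add_single u v t ρ j' e
        rw [← hμρ] at hw1
        rw [← hμ'ρ] at hw2
        have := mul_le_mul_of_nonneg_left hle' hepos
        linarith
    -- count the fibre through the injection into `∏_{l < L-1} (slot set l+1)`
    have himg : G.image (fun μ => fun l : Fin (L - 1) => lab μ ((l : ℕ) + 1)) ⊆
        Fintype.piFinset fun l : Fin (L - 1) => G.image fun μ => lab μ ((l : ℕ) + 1) := by
      intro g hg
      obtain ⟨μ, hμ, rfl⟩ := Finset.mem_image.1 hg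
      exact Fintype.mem_piFinset.2 fun l => Finset.mem_image_of_mem _ hμ
    calc G.card = (G.image fun μ => fun l : Fin (L - 1) => lab μ ((l : ℕ) + 1)).card :=
          (Finset.card_image_of_injOn hinj).symm
      _ ≤ (Fintype.piFinset fun l : Fin (L - 1) => G.image fun μ => lab μ ((l : ℕ) + 1)).card :=
          Finset.card_le_card himg
      _ = ∏ l : Fin (L - 1), (G.image fun μ => lab μ ((l : ℕ) + 1)).card := Fintype.card_piFinset _
      _ ≤ ∏ _l : Fin (L - 1), n := Finset.prod_le_prod' fun l _ => hslot _ (by omega)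
      _ = n ^ (L - 1) := by simp
      _ ≤ n ^ (Lm - 1) := Nat.pow_le_pow_right hnpos (by omega)
  -- assemble
  calc C.card ≤ n ^ (Lm - 1) * (C.image key).card := Finset.card_le_mul_card_image C _ hfib
    _ ≤ n ^ (Lm - 1) * ((Lm + 1) * n ^ Lm) := Nat.mul_le_mul_left _ hkey_card
    _ = (Lm + 1) * (n ^ (Lm - 1) * n ^ Lm) := by ring
    _ ≤ (Lm + 1) * n ^ (2 * Lm) := by
        refine Nat.mul_le_mul_left _ ?_
        rw [← pow_add]
        exact Nat.pow_le_pow_right hnpos (by omega)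

/-- **PENCIL COUNT (finite shift rank).**  For `F(β + w) = Σ_{i∈ι} col β i · ch i w` on `ℕ^s` and any real pencil
`u + t·v`, every finite set of points `μ` with `F(μ) ≠ 0`, each the STRICT `(u + t v)`-minimiser of `{F ≠ 0}` for
some real `t`, has at most `2(s² + 1)·(log₂|ι| + 1)·|ι|^{2 log₂|ι|}` elements (sweep over the `≤ 2(s²+1)` cells of
`pencilOrder_classes` × the per-cell bound `ShiftRank.pencilCount_cell`). [folklore] -/
theorem pencilCount {ι : Type*} [Fintype ι] {F : (Fin s → ℕ) → ℂ} {col : (Fin s → ℕ) → ι → ℂ}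
    {ch : ι → (Fin s → ℕ) → ℂ} (hF : ∀ β w : Fin s → ℕ, F (β + w) = ∑ i, col β i * ch i w) (u v : Fin s → ℝ)
    (S : Finset (Fin s → ℕ))
    (hS : ∀ μ ∈ S, F μ ≠ 0 ∧ ∃ t : ℝ, ∀ ν : Fin s → ℕ, ν ≠ μ → F ν ≠ 0 →
        ∑ i, (u i + t * v i) * (μ i : ℝ) < ∑ i, (u i + t * v i) * (ν i : ℝ)) :
    S.card ≤ 2 * (s * s + 1) *
      ((Nat.log 2 (Fintype.card ι) + 1) * Fintype.card ι ^ (2 * Nat.log 2 (Fintype.card ι))) := by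
  classical
  obtain ⟨code, hcode_mem, hcode⟩ := pencilOrder_classes u v
  -- choose the parameters
  have hS' : ∀ μ ∈ S, ∃ t : ℝ, ∀ ν : Fin s → ℕ, ν ≠ μ → F ν ≠ 0 →
      ∑ i, (u i + t * v i) * (μ i : ℝ) < ∑ i, (u i + t * v i) * (ν i : ℝ) := fun μ hμ => (hS μ hμ).2
  choose! τ hτ using hS'
  -- fibres of the cell code are cell families
  have hfib : ∀ k ∈ S.image (fun μ => code (τ μ)), (S.filter fun μ => code (τ μ) = k).card ≤
      (Nat.log 2 (Fintype.card ι) + 1) * Fintype.card ι ^ (2 * Nat.log 2 (Fintype.card ι)) := by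
    intro k hk
    obtain ⟨μ₀, hμ₀, rfl⟩ := Finset.mem_image.1 hk
    refine pencilCount_cell hF u v (fun j j' => u j + τ μ₀ * v j ≤ u j' + τ μ₀ * v j') _ fun μ hμ => ?_
    obtain ⟨hμS, hμk⟩ := Finset.mem_filter.1 hμ
    exact ⟨(hS μ hμS).1, τ μ, hτ μ hμS, fun j j' => hcode _ _ hμk.symm j j'⟩
  have himg : (S.image fun μ => code (τ μ)).card ≤ 2 * (s * s + 1) := by
    calc (S.image fun μ => code (τ μ)).card
        ≤ ((Finset.range (s * s + 1)) ×ˢ (Finset.univ : Finset Bool)).card :=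
          Finset.card_le_card fun k hk => by
            obtain ⟨μ, _, rfl⟩ := Finset.mem_image.1 hk
            exact hcode_mem _
      _ = 2 * (s * s + 1) := by simp [Finset.card_product, mul_comm]
  calc S.card ≤ (Nat.log 2 (Fintype.card ι) + 1) * Fintype.card ι ^ (2 * Nat.log 2 (Fintype.card ι)) *
        (S.image fun μ => code (τ μ)).card := Finset.card_le_mul_card_image S _ hfib
    _ ≤ (Nat.log 2 (Fintype.card ι) + 1) * Fintype.card ι ^ (2 * Nat.log 2 (Fintype.card ι)) *
        (2 * (s * s + 1)) := Nat.mul_le_mul_left _ himg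
    _ = _ := by ring

end ShiftRank

end Summit.ValiantsHypothesis.ValiantsHypothesis.Theorems.NewtonUnitEquations.TwoProducts.FormalLogLinearisation

end
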